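import Literature.NumberTheory.Rogawski1990.RankOneTorusRegularLocalConstancy     -- ★ A-p19 (g22) FILE B: `isUnit_frameDiff_of_isRegularElt`, `normOne_frame_of_mem_centralizer` (via L1)
import Literature.NumberTheory.Rogawski1990.RankOneKappaOrbitalDepthExpansionH     -- ★ A-p13 (g32): `coe_localNonsplitEquiv_mul_map_eq` (the one-place model reads `LocalRing` frames at `w`)
import Literature.NumberTheory.Rogawski1990.UnitaryRankTwoFrameAlgebra            -- ★ `eq_diagonal_of_mul_diagonal_comm` (a matrix commuting with a regular diagonal is diagonal)
import HarnessLib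

/-!
# The elliptic torus `Z(t₀)` framed by ANY eigenframe of `t₀` at a non-split place (R-5b END socket, architect A-28 ∕ A-29 (a))

Literature layer for `stmt-HodgeConjecture-24833` (crux H413), road «R1-ram», the END assembler's (F0P3a-p03 (g12)) `obtain` chain: ★ PAIR p843849
`depthExpansion_pair_ramified_selfDual` takes a frame `Q ∈ GL₂(L_w)` with the binder
`hQ : ∀ t : Z(t₀), E₂(t.1) · Q = Q · diag((τ₀ t)_w, (τ₁ t)_w)` (`τᵢ t := (P⁻¹ · t.1 · P)ᵢᵢ` the `LocalRing` frame entries of ★ L1), while ★ A-p01 p843782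
`exists_diagonal_unit_eigenframe_antidiagTwo_of_ramified` only returns an eigenframe OF `t₀`: `E₂(t₀.1) · Q = Q · diag(d₀_w, d₁_w)`.  This file transfers:
**every `t ∈ Z(t₀)` is diagonal in every eigenframe `Q` of the regular `t₀` at `w`, with entries `(τᵢ t)_w`** — no regularity of `t` needed.

Proof (linear algebra over the field `L_w`, [cite: Rogawski1990, §3.6 p. 31]): let `P_w := P` read at `w` (★ `coe_localNonsplitEquiv_mul_map_eq`:
`E₂(t₀.1) P_w = P_w diag d_w` from `hP`, and `E₂(t.1) P_w = P_w diag (τ t)_w` from ★ `normOne_frame_of_mem_centralizer`); `M := P_w⁻¹ Q` commutes with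
`diag d_w` (both `P_w` and `Q` are eigenframes of `E₂(t₀.1)`), `d₀_w ≠ d₁_w` (`t₀` regular, ★ `isUnit_frameDiff_of_isRegularElt` at `t₀`) ⇒ `M` diagonal
(★ `eq_diagonal_of_mul_diagonal_comm`) ⇒ `E₂(t.1) Q = E₂(t.1) P_w M = P_w diag(τ_w) M = P_w M diag(τ_w) = Q diag(τ_w)`.
-/

open NumberField IsDedekindDomain Matrix
open scoped MatrixGroups

open Literature.NumberTheory.Automorphic Literature.NumberTheory.Automorphic.UnitaryGroup Literature.NumberTheory.GaloisRepresentations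

namespace Literature.NumberTheory.Rogawski1990

section Eigenframe

variable (L : Type) [Field L] [NumberField L] [IsCMField L] (v : HeightOneSpectrum (𝓞 ↥(maximalRealSubfield L)))

/-- **EIGENFRAME TRANSFER ALONG THE TORUS.**  For an elliptic regular frame `(t₀, P, d)` of `H_v = U(Φ₂)_v × U(Φ₁)_v` at a non-split `w ∣ v`, the one-place model `E₂`
(★ PAIR's `hE₂`), and ANY `Q ∈ GL₂(L_w)` with `E₂(t₀.1) · Q = Q · diag(d₀_w, d₁_w)`: for EVERY `t ∈ Z(t₀)`,
**`E₂(t.1) · Q = Q · diag(((P⁻¹ t.1 P)₀₀)_w, ((P⁻¹ t.1 P)₁₁)_w)`** — ★ PAIR p843849's binder `hQ`, token for token. [cite: Rogawski1990, §3.6 p. 31] [cite: LabesseLanglands1979, §2 p. 8] -/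
theorem frameEntry_frame_of_eigenframe (w : PlacesOver L v) (hw : IsCMField.complexConj L • w.1 = w.1)
    (t₀ : ((cmDatum L 2 (Matrix.of fun i j : Fin 2 => if i.val + j.val + 1 = 2 then (1 : L) else 0)).Local v × (cmDatum L 1 (Matrix.of fun i j : Fin 1 => if i.val + j.val + 1 = 1 then (1 : L) else 0)).Local v)) (P : GL (Fin 2) (LocalRing L v)) (d : Fin 2 → (LocalRing L v)) (ht₀ : IsRegularElt (t₀.1.val : GL (Fin 2) (LocalRing L v)))
    (hP : (t₀.1.val.val : Matrix (Fin 2) (Fin 2) (LocalRing L v)) * P.val = P.val * Matrix.diagonal d) (hd1 : ∀ i, conjLocal L (IsCMField.complexConj L) v (d i) * d i = 1)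
    (E₂ : (cmDatum L 2 (Matrix.of fun i j : Fin 2 => if i.val + j.val + 1 = 2 then (1 : L) else 0)).Local v ≃ₜ* ↥(unitaryGroupOfForm (galAdicCompletionMap (L := L) (IsCMField.complexConj L) hw) (placeForm (Matrix.of fun i j : Fin 2 => if i.val + j.val + 1 = 2 then (1 : L) else 0) w.1)))
    (hE₂ : ∀ g, ((E₂ g : ↥(unitaryGroupOfForm (galAdicCompletionMap (L := L) (IsCMField.complexConj L) hw) (placeForm (Matrix.of fun i j : Fin 2 => if i.val + j.val + 1 = 2 then (1 : L) else 0) w.1))) : GL (Fin 2) (w.1.adicCompletion L)) = ((localNonsplitEquiv (IsCMField.complexConj L) (Matrix.of fun i j : Fin 2 => if i.val + j.val + 1 = 2 then (1 : L) else 0) (IsCMField.complexConj_ne_one L) w hw g : ↥(unitaryGroupOfForm (galAdicCompletionMap (L := L) (IsCMField.complexConj L) hw) (placeForm (Matrix.of fun i j : Fin 2 => if i.val + j.val + 1 = 2 then (1 : L) else 0) w.1))) : GL (Fin 2) (w.1.adicCompletion L)))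
    (Q : GL (Fin 2) (w.1.adicCompletion L))
    (hQ₀ : (((E₂ t₀.1 : ↥(unitaryGroupOfForm (galAdicCompletionMap (L := L) (IsCMField.complexConj L) hw) (placeForm (Matrix.of fun i j : Fin 2 => if i.val + j.val + 1 = 2 then (1 : L) else 0) w.1))) : GL (Fin 2) (w.1.adicCompletion L)) : Matrix (Fin 2) (Fin 2) (w.1.adicCompletion L)) * (Q : Matrix (Fin 2) (Fin 2) (w.1.adicCompletion L)) =
      (Q : Matrix (Fin 2) (Fin 2) (w.1.adicCompletion L)) * diagonal ![d 0 w, d 1 w]) :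
    ∀ t : ↥(Subgroup.centralizer ({t₀} : Set ((cmDatum L 2 (Matrix.of fun i j : Fin 2 => if i.val + j.val + 1 = 2 then (1 : L) else 0)).Local v × (cmDatum L 1 (Matrix.of fun i j : Fin 1 => if i.val + j.val + 1 = 1 then (1 : L) else 0)).Local v))), (((E₂ ((t : ((cmDatum L 2 (Matrix.of fun i j : Fin 2 => if i.val + j.val + 1 = 2 then (1 : L) else 0)).Local v × (cmDatum L 1 (Matrix.of fun i j : Fin 1 => if i.val + j.val + 1 = 1 then (1 : L) else 0)).Local v))).1 : ↥(unitaryGroupOfForm (galAdicCompletionMap (L := L) (IsCMField.complexConj L) hw) (placeForm (Matrix.of fun i j : Fin 2 => if i.val + j.val + 1 = 2 then (1 : L) else 0) w.1))) : GL (Fin 2) (w.1.adicCompletion L)) : Matrix (Fin 2) (Fin 2) (w.1.adicCompletion L)) * (Q : Matrix (Fin 2) (Fin 2) (w.1.adicCompletion L)) =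
      (Q : Matrix (Fin 2) (Fin 2) (w.1.adicCompletion L)) * diagonal ![(((P⁻¹).val * ((t : ((cmDatum L 2 (Matrix.of fun i j : Fin 2 => if i.val + j.val + 1 = 2 then (1 : L) else 0)).Local v × (cmDatum L 1 (Matrix.of fun i j : Fin 1 => if i.val + j.val + 1 = 1 then (1 : L) else 0)).Local v)).1.val.val : Matrix (Fin 2) (Fin 2) (LocalRing L v)) * P.val) 0 0) w, (((P⁻¹).val * ((t : ((cmDatum L 2 (Matrix.of fun i j : Fin 2 => if i.val + j.val + 1 = 2 then (1 : L) else 0)).Local v × (cmDatum L 1 (Matrix.of fun i j : Fin 1 => if i.val + j.val + 1 = 1 then (1 : L) else 0)).Local v)).1.val.val : Matrix (Fin 2) (Fin 2) (LocalRing L v)) * P.val) 1 1) w] := by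
  classical
  intro t
  -- abbreviations at `w`
  set Pw : GL (Fin 2) (w.1.adicCompletion L) := Matrix.GeneralLinearGroup.map (Pi.evalRingHom (fun w' : PlacesOver L v => w'.1.adicCompletion L) w) P with hPwdef
  have hPP : (Pw⁻¹).val * Pw.val = 1 := by rw [← Units.val_mul, inv_mul_cancel, Units.val_one]
  have hPP' : Pw.val * (Pw⁻¹).val = 1 := by rw [← Units.val_mul, mul_inv_cancel, Units.val_one]
  -- the two `LocalRing` frames read at `w`
  obtain ⟨-, hPt⟩ := normOne_frame_of_mem_centralizer L v w hw t₀ P d ht₀ hP hd1 _ t.2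
  have hT0 := coe_localNonsplitEquiv_mul_map_eq L v w hw t₀.1 P (Matrix.diagonal d) hP
  have hTt := coe_localNonsplitEquiv_mul_map_eq L v w hw (t : ((cmDatum L 2 (Matrix.of fun i j : Fin 2 => if i.val + j.val + 1 = 2 then (1 : L) else 0)).Local v × (cmDatum L 1 (Matrix.of fun i j : Fin 1 => if i.val + j.val + 1 = 1 then (1 : L) else 0)).Local v)).1 P _ hPt
  rw [← hE₂, ← hPwdef, Matrix.diagonal_map (map_zero _)] at hT0 hTt
  have hdτ : (diagonal fun i => Pi.evalRingHom (fun w' : PlacesOver L v => w'.1.adicCompletion L) w (![((P⁻¹).val * ((t : ((cmDatum L 2 (Matrix.of fun i j : Fin 2 => if i.val + j.val + 1 = 2 then (1 : L) else 0)).Local v × (cmDatum L 1 (Matrix.of fun i j : Fin 1 => if i.val + j.val + 1 = 1 then (1 : L) else 0)).Local v)).1.val.val : Matrix (Fin 2) (Fin 2) (LocalRing L v)) * P.val) 0 0, ((P⁻¹).val * ((t : ((cmDatum L 2 (Matrix.of fun i j : Fin 2 => if i.val + j.val + 1 = 2 then (1 : L) else 0)).Local v × (cmDatum L 1 (Matrix.of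 fun i j : Fin 1 => if i.val + j.val + 1 = 1 then (1 : L) else 0)).Local v)).1.val.val : Matrix (Fin 2) (Fin 2) (LocalRing L v)) * P.val) 1 1] i)) = diagonal ![(((P⁻¹).val * ((t : ((cmDatum L 2 (Matrix.of fun i j : Fin 2 => if i.val + j.val + 1 = 2 then (1 : L) else 0)).Local v × (cmDatum L 1 (Matrix.of fun i j : Fin 1 => if i.val + j.val + 1 = 1 then (1 : L) else 0)).Local v)).1.val.val : Matrix (Fin 2) (Fin 2) (LocalRing L v)) * P.val) 0 0) w, (((P⁻¹).val * ((t : ((cmDatum L 2 (Matrix.of fun i j : Fin 2 => if i.val + j.val + 1 = 2 then (1 : L) else 0)).Local v × (cmDatum L 1 (Matrix.of fun i j : Fin 1 => if i.val + j.val + 1 = 1 then (1 : L) else 0)).Local v)).1.val.val : Matrix (Fin 2) (Fin 2) (LocalRing L v)) * P.val) 1 1) w] := by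
    congr 1; funext i; fin_cases i <;> rfl
  have hdd : (diagonal fun i => Pi.evalRingHom (fun w' : PlacesOver L v => w'.1.adicCompletion L) w (d i)) = diagonal ![d 0 w, d 1 w] := by
    congr 1; funext i; fin_cases i <;> rfl
  rw [hdd] at hT0
  rw [hdτ] at hTt
  -- `d₀_w ≠ d₁_w`: `t₀` is regular
  have ht0mem : t₀ ∈ Subgroup.centralizer ({t₀} : Set ((cmDatum L 2 (Matrix.of fun i j : Fin 2 => if i.val + j.val + 1 = 2 then (1 : L) else 0)).Local v × (cmDatum L 1 (Matrix.of fun i j : Fin 1 => if i.val + j.val + 1 = 1 then (1 : L) else 0)).Local v)) := Subgroup.mem_centralizer_iff.2 fun g hg => by rw [Set.mem_singleton_iff.1 hg]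
  have hdiag0 : (P⁻¹).val * (t₀.1.val.val : Matrix (Fin 2) (Fin 2) (LocalRing L v)) * P.val = Matrix.diagonal d := by
    rw [Matrix.mul_assoc, hP, ← Matrix.mul_assoc, show (P⁻¹).val * P.val = 1 from by rw [← Units.val_mul, inv_mul_cancel, Units.val_one], Matrix.one_mul]
  have hu := isUnit_frameDiff_of_isRegularElt L v w hw t₀ P d ht₀ hP hd1 ⟨t₀, ht0mem⟩ ht₀
  have hd01 : d 0 w ≠ d 1 w := by
    have h := (hu.map (Pi.evalRingHom (fun w' : PlacesOver L v => w'.1.adicCompletion L) w)).ne_zero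
    simp only [hdiag0, diagonal_apply_eq, map_sub, Pi.evalRingHom_apply] at h
    exact sub_ne_zero.1 h
  -- `M := P_w⁻¹ Q` commutes with `diag d_w`, hence is diagonal
  set M : Matrix (Fin 2) (Fin 2) (w.1.adicCompletion L) := (Pw⁻¹).val * (Q : Matrix (Fin 2) (Fin 2) (w.1.adicCompletion L)) with hMdef
  have hE0P : (Pw⁻¹).val * (((E₂ t₀.1 : ↥(unitaryGroupOfForm (galAdicCompletionMap (L := L) (IsCMField.complexConj L) hw) (placeForm (Matrix.of fun i j : Fin 2 => if i.val + j.val + 1 = 2 then (1 : L) else 0) w.1))) : GL (Fin 2) (w.1.adicCompletion L)) : Matrix (Fin 2) (Fin 2) (w.1.adicCompletion L)) = diagonal ![d 0 w, d 1 w] * (Pw⁻¹).val := by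
    have h := congrArg (fun X => (Pw⁻¹).val * X * (Pw⁻¹).val) hT0
    simp only [← Matrix.mul_assoc] at h
    rw [Matrix.mul_assoc ((Pw⁻¹).val * _) Pw.val, hPP', Matrix.mul_one, Matrix.mul_assoc (Pw⁻¹).val Pw.val, ← Matrix.mul_assoc, hPP, Matrix.one_mul] at h
    exact h
  have hMcomm : M * diagonal ![d 0 w, d 1 w] = diagonal ![d 0 w, d 1 w] * M := by
    rw [hMdef, Matrix.mul_assoc, ← hQ₀, ← Matrix.mul_assoc, hE0P, Matrix.mul_assoc]
  have hM := eq_diagonal_of_mul_diagonal_comm (d := ![d 0 w, d 1 w]) hd01 M hMcomm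
  have hQM : (Q : Matrix (Fin 2) (Fin 2) (w.1.adicCompletion L)) = Pw.val * M := by
    rw [hMdef, ← Matrix.mul_assoc, hPP', Matrix.one_mul]
  -- diagonal matrices commute
  have hDM : diagonal ![(((P⁻¹).val * ((t : ((cmDatum L 2 (Matrix.of fun i j : Fin 2 => if i.val + j.val + 1 = 2 then (1 : L) else 0)).Local v × (cmDatum L 1 (Matrix.of fun i j : Fin 1 => if i.val + j.val + 1 = 1 then (1 : L) else 0)).Local v)).1.val.val : Matrix (Fin 2) (Fin 2) (LocalRing L v)) * P.val) 0 0) w, (((P⁻¹).val * ((t : ((cmDatum L 2 (Matrix.of fun i j : Fin 2 => if i.val + j.val + 1 = 2 then (1 : L) else 0)).Local v × (cmDatum L 1 (Matrix.of fun i j : Fin 1 => if i.val + j.val + 1 = 1 then (1 : L) else 0)).Local v)).1.val.val : Matrix (Fin 2) (Fin 2) (LocalRing L v)) * P.val) 1 1) w] * M = M * diagonal ![(((P⁻¹).val * ((t : ((cmDatum L 2 (Matrix.of fun i j : Fin 2 => if i.val + j.val + 1 = 2 then (1 : L) else 0)).Local v × (cmDatum L 1 (Matrix.of fun i j : Fin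 1 => if i.val + j.val + 1 = 1 then (1 : L) else 0)).Local v)).1.val.val : Matrix (Fin 2) (Fin 2) (LocalRing L v)) * P.val) 0 0) w, (((P⁻¹).val * ((t : ((cmDatum L 2 (Matrix.of fun i j : Fin 2 => if i.val + j.val + 1 = 2 then (1 : L) else 0)).Local v × (cmDatum L 1 (Matrix.of fun i j : Fin 1 => if i.val + j.val + 1 = 1 then (1 : L) else 0)).Local v)).1.val.val : Matrix (Fin 2) (Fin 2) (LocalRing L v)) * P.val) 1 1) w] := by
    rw [hM, diagonal_mul_diagonal, diagonal_mul_diagonal]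
    congr 1; funext i; exact mul_comm _ _
  -- assemble
  rw [hQM, ← Matrix.mul_assoc, hTt, Matrix.mul_assoc, hDM]
  exact (Matrix.mul_assoc _ _ _).symm

end Eigenframe

end Literature.NumberTheory.Rogawski1990
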